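import Literature.AnabelianGeometry.AbsoluteAnabelian.AbsTopIII.ReconstructionCor110iiPrime
import Literature.AnabelianGeometry.AbsoluteAnabelian.LocalReciprocityCompletionProofs
import Literature.NumberTheory.GaloisRepresentations.LocalGlobalCohomologyFiniteProofs
import Literature.NumberTheory.GaloisRepresentations.TateDualityCounting
import HarnessLib

/-!
# [AbsTopIII] Cor. 1.10 (ii)(d) strengthened — reading (D) PROVED: `AbsTopIII.cor_1_10_ii'_holds`

Mochizuki, *Topics in Absolute Anabelian Geometry III*, Cor. 1.10 (ii)(d) pp. 42–43 (manuscript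
pagination, lit key `paper:url-5493eb38cbb7`): «One constructs the image of the Kummer map
`k^× ↪ H¹(G_k, μ_Ẑ(·))` … as the inverse image of the subgroup generated by the Frobenius element via
the surjection `H¹(G_k, μ_Ẑ(·)) ⥲ H¹(G_k, μ_Ẑ(G_k)) ⥲ G_k^ab ↠ Ẑ` of (b)».

PROOF-ONLY companion (abc-iut layer L4, row «Cor110ii-PRIME», abc-iut-L4-d1) of the statements file
`ReconstructionCor110iiPrime.lean` (`AbsTopIII.Cor_1_10_ii'`, reading (D)).  For an MLF `k` (valued form)
and a `G_k`-equivariant `φ : μ_{ℚ/ℤ}(G_k) ≅ μ(k̄)`, the isomorphism of (i)(b)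
`j := H¹(φ) ≫ (H¹(G_k, Ẑ(1)) ≃ (kˣ)^∧) ≫ e`, with `e : (kˣ)^∧ ⥲ₜ G_k^ab` a reciprocity isomorphism
(`mlf_reciprocity_completion_holds`, abc-iut-L4-d1 gen 0) and the middle isomorphism abc-iut-L4-t11's
`continuousCohomologyOneTateModuleEquivCompletion` (NSW II §7 Thm. 2.7.5 + Kummer theory), satisfies:
`j ∘ H¹(φ)⁻¹ ∘ κ̂ = e ∘ η` on `kˣ` (`reciprocityOfContainerIso_containerIso` — the key identity
`continuousCohomologyOneTateModuleEquivCompletion (κ̂ a) = η a`, read levelwise: both have `n`-th Kummer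
coordinate `δ_n(a)`), and `e ∘ η` IS a local reciprocity map (`IsLocalReciprocityMap`).  Hence
`AbsTopIII.cor_1_10_ii'_holds`; in particular the Kummer image of `kˣ` in `H¹(G_k, μ_Ẑ(G_k))` is
`j⁻¹(𝔄_k⁰)`, the Frobenius-integral part.  Theorems only (proof-only file: no
definition, no named fact, no `sorry`).  HONEST FRAMING: classical local class field
theory and Kummer theory; nothing here bears on [IUTchIII] Cor. 3.12 or takes a side.
-/

noncomputable section

open CategoryTheory Function
open Field ValuativeRel

universe u

namespace Literature.AnabelianGeometry.AbsoluteAnabelian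

open _root_.TopRep _root_.ContRepresentation _root_.ContinuousCohomology
open Literature.NumberTheory.GaloisRepresentations
open Literature.NumberTheory.GaloisRepresentations.DiscreteGaloisModule
open ProfiniteGrp ProfiniteGrp.ProfiniteCompletion

namespace Cor110iiPrime

section Valued

variable (k : Type u) [Field k] [ValuativeRel k] [TopologicalSpace k] [IsNonarchimedeanLocalField k]
  [CharZero k]

/-- The power subgroups `(kˣ)ⁿ` of an MLF have finite index (tree
`finite_quotient_range_powMonoidHom_units`, Serre CG II §5.1 (a), read for the valued form through the
canonical uniform structure of the topological field `k`). [cite: SerreGaloisCohomology1997, II §5.1 (a)] -/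
theorem finiteIndex_range_powMonoidHom (n : ℕ+) :
    ((powMonoidHom (n : ℕ) : kˣ →* kˣ).range).FiniteIndex := by
  letI : UniformSpace k := IsTopologicalAddGroup.rightUniformSpace k
  haveI : IsUniformAddGroup k := isUniformAddGroup_of_addCommGroup
  haveI := finite_quotient_range_powMonoidHom_units k n (Nat.cast_ne_zero.2 n.ne_zero)
  exact Subgroup.finiteIndex_of_finite_quotient

end Valued

section Completion

variable (k : Type u) [Field k] [CharZero k]
  (hfin : ∀ n : ℕ+, ((powMonoidHom (n : ℕ) : kˣ →* kˣ).range).FiniteIndex)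

omit [CharZero k] in
/-- The power components of `η(a) ∈ (kˣ)^∧` are the classes of `a`. [cite: RibesZalesskii2010, Thm 2.7.1] -/
theorem proj_eta (n : ℕ+) (a : kˣ) :
    PowCompletion.proj hfin n ((eta (GrpCat.of kˣ)).hom a) = QuotientGroup.mk a :=
  rfl

/-- `(kˣ)^∧ ⥲ lim_n H¹(G_k, μ_n)` carries `η(a)` to the family of Kummer classes of `a`.
[cite: SerreGaloisCohomology1997, II §1.2] -/
theorem completionUnitsEquivCohomologyLimitMu_eta (a : kˣ) :
    completionUnitsEquivCohomologyLimitMu k hfin ((eta (GrpCat.of kˣ)).hom a) =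
      Multiplicative.ofAdd (kummerFamily k a) := by
  apply Multiplicative.toAdd.injective
  refine Subtype.ext (funext fun n => ?_)
  rw [toAdd_ofAdd, coe_kummerFamily_apply]
  change ((Multiplicative.toAdd (completionUnitsToCohomologyLimit k hfin ((eta (GrpCat.of kˣ)).hom a)) :
      (muSystem k).cohomologyLimit 1) : ∀ n, continuousCohomology 1 ((muSystem k).ρ n).toTopRep) n = _
  rw [completionUnitsToCohomologyLimit_apply, proj_eta, kummerLift_mk]

/-- **`H¹_cont(G_k, Ẑ(1)) ⥲ (kˣ)^∧` carries the Kummer class `κ̂(a)` to `η(a)`** — the Kummer map with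
`Ẑ(1)`-coefficients followed by abc-iut-L4-t11's comparison isomorphism is the canonical map of `kˣ`
into its profinite completion. [cite: MochizukiAbsTopIII2015, Cor 1.10 (ii) p.42] -/
theorem continuousCohomologyOneTateModuleEquivCompletion_kummerTate (a : kˣ) :
    continuousCohomologyOneTateModuleEquivCompletion k hfin (Multiplicative.toAdd (kummerTate k a)) =
      Additive.ofMul ((eta (GrpCat.of kˣ)).hom a) := by
  change Additive.ofMul ((completionUnitsEquivCohomologyLimitMu k hfin).symm (Multiplicative.ofAdd
    (continuousCohomologyOneTateModuleEquiv k (Multiplicative.toAdd (kummerTate k a))))) = _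
  rw [continuousCohomologyOneTateModuleEquiv_kummerTate, ← completionUnitsEquivCohomologyLimitMu_eta k hfin a,
    MulEquiv.symm_apply_apply]

end Completion

section Container

variable (k : Type u) [Field k] [CharZero k]
  (hfin : ∀ n : ℕ+, ((powMonoidHom (n : ℕ) : kˣ →* kˣ).range).FiniteIndex)
  (φ : muQZ (absoluteGaloisGroup k) ≃+ Additive (CommGroup.torsion (AlgebraicClosure k)ˣ))
  (hφ : ∀ (σ : absoluteGaloisGroup k) (x : muQZ (absoluteGaloisGroup k)),
      (((Additive.toMul (φ (σ • x)) : CommGroup.torsion (AlgebraicClosure k)ˣ) :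
          (AlgebraicClosure k)ˣ) : AlgebraicClosure k) =
        σ • (((Additive.toMul (φ x) : CommGroup.torsion (AlgebraicClosure k)ˣ) :
          (AlgebraicClosure k)ˣ) : AlgebraicClosure k))
  (e : completion (GrpCat.of kˣ) ≃ₜ* absoluteGaloisGroupAbelianization k)

/-- **The isomorphism `j : H¹(G_k, μ_Ẑ(G_k)) ≃+ G_k^ab` of Cor. 1.10 (i)(b)** assembled from a
coefficient identification `φ` (`H¹(φ)`, cohomology of abc-iut-L4-t11's `galCyclotomeIsoTateModule`),
abc-iut-L4-t11's `H¹(G_k, Ẑ(1)) ≃ (kˣ)^∧` and a reciprocity isomorphism `e : (kˣ)^∧ ≃ₜ* G_k^ab` has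
candidate reciprocity map LITERALLY `e ∘ η` on `kˣ` (the Kummer class `κ̂(a)` goes to `η(a)`).
[cite: MochizukiAbsTopIII2015, Cor 1.10 (ii) p.42] -/
theorem reciprocityOfContainerIso_eq :
    reciprocityOfContainerIso hφ
        (((AddEquiv.mk' (continuousCohomologyEquivOfIso (galCyclotomeIsoTateModule k φ hφ) 1)
              fun x y => map_add (cohomologyMap (galCyclotomeIsoTateModule k φ hφ).hom 1).hom x y).trans
            (continuousCohomologyOneTateModuleEquivCompletion k hfin)).trans
          (MulEquiv.toAdditive e.toMulEquiv)) =
      (e.toMulEquiv.toMonoidHom).comp (eta (GrpCat.of kˣ)).hom := by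
  refine MonoidHom.ext fun a => ?_
  change e (Additive.toMul (continuousCohomologyOneTateModuleEquivCompletion k hfin
    (continuousCohomologyEquivOfIso (galCyclotomeIsoTateModule k φ hφ) 1
      ((cohomologyMap (galCyclotomeIsoTateModule k φ hφ).inv 1).hom
        (Multiplicative.toAdd (kummerTate k a)))))) = e ((eta (GrpCat.of kˣ)).hom a)
  congr 1
  change Additive.toMul (continuousCohomologyOneTateModuleEquivCompletion k hfin
    ((cohomologyMap (galCyclotomeIsoTateModule k φ hφ).hom 1).hom
      ((cohomologyMap (galCyclotomeIsoTateModule k φ hφ).inv 1).hom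
        (Multiplicative.toAdd (kummerTate k a))))) = _
  rw [show (cohomologyMap (galCyclotomeIsoTateModule k φ hφ).hom 1).hom
      ((cohomologyMap (galCyclotomeIsoTateModule k φ hφ).inv 1).hom (Multiplicative.toAdd (kummerTate k a))) =
      Multiplicative.toAdd (kummerTate k a) from
    cohomologyMap_inv_hom_apply (galCyclotomeIsoTateModule k φ hφ).symm 1 _,
    continuousCohomologyOneTateModuleEquivCompletion_kummerTate, toMul_ofMul]

end Container

end Cor110iiPrime

/-- **[AbsTopIII] Cor. 1.10 (ii)(d) STRENGTHENED — reading (D) PROVED.**  For every MLF `k` and every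
`G_k`-equivariant `φ : μ_{ℚ/ℤ}(G_k) ≅ μ(k̄)`, the isomorphism `j : H¹(G_k, μ_Ẑ(G_k)) ≃+ G_k^ab` built from
`H¹(φ)`, Kummer theory in the limit (`H¹(G_k, Ẑ(1)) ≃ (kˣ)^∧`, abc-iut-L4-t11) and the reciprocity
isomorphism `(kˣ)^∧ ⥲ G_k^ab` (`mlf_reciprocity_completion_holds`, abc-iut-L4-d1 gen 0) makes
`kˣ —κ̂→ H¹(G_k, Ẑ(1)) —H¹(φ)⁻¹→ H¹(G_k, μ_Ẑ(G_k)) —j→ G_k^ab` a local reciprocity map: it is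
LITERALLY the reciprocity map `θ = e ∘ η` (the Kummer class `κ̂(a)` goes to `η(a)`).  Hence the Kummer
image of `kˣ` in the real container is `j⁻¹(𝔄_k⁰)` — «the inverse image of the subgroup generated by the
Frobenius element». [cite: MochizukiAbsTopIII2015, Cor 1.10 (ii) p.42] -/
theorem AbsTopIII.cor_1_10_ii'_holds :
    Literature.AnabelianGeometry.AbsoluteAnabelian.AbsTopIII.Cor_1_10_ii'.{u} := by
  intro k _ _ _ _ _ φ hφ
  obtain ⟨e, he⟩ := mlf_reciprocity_completion_holds k
  exact ⟨_, (Cor110iiPrime.reciprocityOfContainerIso_eq k (Cor110iiPrime.finiteIndex_range_powMonoidHom k)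
    φ hφ e).symm ▸ he⟩

end Literature.AnabelianGeometry.AbsoluteAnabelian
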